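import Summits.HodgeConjecture.CorCM.Census.DicyclicTwistGenerators

/-!
# The dicyclic twist `Dic(A) ⊃ ℤ/2 × A`, IX: the generation theorem — reducing faces and two closing squares generate the Hodge lattice
# modulo pairs

COR-CM (cell `pub-hodgecm2`, stage 2 of the Hodge ladder), count-neutral KERNEL COMBINATORICS by the binder seat b23 (gen 42; claim
DICYCLIC-COLUMN, HOME/INBOX.md l.10328): part IX of the lane `DicyclicTwist*`.  Bookkeeping definition with body (`redSpan`) + theorems on top of
parts I–VIII; no `decide` table, no certificate, no named fact, no geometry, no `sorry`.  `Interfaces.lean` (C1), every E term, B01,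
`Transposition/*`, `PortJoin/*` untouched.
HONEST FRAMING: `HC_CM` is NOT proved, here or anywhere in the tree; nothing here is a period, a count of record or a headline.

THE THEOREM (`|A|` odd, `≥ 3`; `G = Dic(A)`).  **`hodge₂_le`**: for every submodule `S ≤ H₂` which (i) contains, through every label of potential
`≥ 2`, a vector equal to `1` there and otherwise supported in smaller potential, and (ii) is killed by the `2|A| + 2` functionals
`U s, U' s, C₀, C₁` of part IV,
  **`H₂ ≤ P₂ ⊔ S ⊔ closingSpan`**,
where `closingSpan = ℤ[G]f₁ + ℤ[G]f₂` is spanned by the translates of the two equator-crossing squares of part VIII.  **`hodge₂_le_redSpan`**: the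
span `redSpan` of all reducing faces (part III) is such an `S`, so the Hodge lattice of `(Dic(A), c)` is generated modulo pairs by the reducing
rank-four faces and the `G`-translates of `f₁`, `f₂`.  (Part X, the census count, replaces `redSpan` by the translates of ONE reducing face per
non-residual block: `β(G) − 3` faces, i.e. `μ(Dic(A)) ≤ β − 1` — the value `μ(Dic₃) = 5`, `μ(Dic₅) = 51` of lit-andre-3's kernel atlases.)
PROOF.  Reduce `y ∈ H₂` modulo `S` to the residual labels (part III) and modulo `P₂` to the normal ones (part V); the functionals do not change;
`|A|` divides `C₀`, `C₁` there (part VI), so the generators of part VIII produce `n ∈ closingSpan` with the same `2|A|+2` functionals; the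
normal reduction of `y − n` has all functionals zero, hence vanishes (key lemma, part VI), i.e. `y − n ∈ S ⊔ P₂`.  All [folklore].

## References
* [Pohlmann1968] H. Pohlmann, Algebraic cycles on abelian varieties of complex multiplication type, Ann. of Math. 88 (1968), Thm 1.
* [Milne1999] J. S. Milne, Lefschetz motives and the Tate conjecture, Compositio Math. 117 (1999), Prop. 2.1, p. 54.
-/

namespace Summit.HodgeConjecture.CorCM.Census.DicyclicTwist

open Finset
open Summit.HodgeConjecture.CorCM.Census.OddSliceFacesModel
open Summit.HodgeConjecture.CorCM.Census.OddSliceFacesSquares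
open Summit.HodgeConjecture.CorCM.Census.OddSliceFacesDescent
open Summit.HodgeConjecture.CorCM.Census.EvenSliceFacesDescent
open Summit.HodgeConjecture.CorCM.Census.OddSliceFacesGenerate

variable (A : Type) [AddCommGroup A] [Fintype A] [DecidableEq A]

/-! ## §1 The functionals vanish on pairs; normal reduction -/


omit [AddCommGroup A] in
/-- Vanishing of the residual functionals is closed under subtraction. [folklore] -/
theorem killed_sub {v w : Ty₂ A → ℤ} (hv : ((∀ s, U A s v = 0) ∧ (∀ s, U' A s v = 0) ∧ C₀ A v = 0 ∧ C₁ A v = 0)) (hw : ((∀ s, U A s w = 0) ∧ (∀ s, U' A s w = 0) ∧ C₀ A w = 0 ∧ C₁ A w = 0)) : ((∀ s, U A s (v - w) = 0) ∧ (∀ s, U' A s (v - w) = 0) ∧ C₀ A (v - w) = 0 ∧ C₁ A (v - w) = 0) := by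
  refine ⟨fun s => ?_, fun s => ?_, ?_, ?_⟩
  · rw [map_sub, hv.1 s, hw.1 s, sub_zero]
  · rw [map_sub, hv.2.1 s, hw.2.1 s, sub_zero]
  · rw [map_sub, hv.2.2.1, hw.2.2.1, sub_zero]
  · rw [map_sub, hv.2.2.2, hw.2.2.2, sub_zero]

omit [AddCommGroup A] in
/-- **The functionals vanish on `P₂`.** [folklore] -/
theorem killed_of_mem_pairs₂ (hA : Odd (Fintype.card A)) {v : Ty₂ A → ℤ} (hv : v ∈ pairs₂ A) : ((∀ s, U A s v = 0) ∧ (∀ s, U' A s v = 0) ∧ C₀ A v = 0 ∧ C₁ A v = 0) := by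
  refine Submodule.span_induction (p := fun w _ => ((∀ s, U A s w = 0) ∧ (∀ s, U' A s w = 0) ∧ C₀ A w = 0 ∧ C₁ A w = 0)) ?_ ?_ ?_ ?_ hv
  · rintro _ ⟨Ψ, rfl⟩
    exact ⟨fun s => U_pairVec₂ A hA s Ψ, fun s => U'_pairVec₂ A hA s Ψ, C₀_pairVec₂ A hA Ψ, C₁_pairVec₂ A hA Ψ⟩
  · exact ⟨fun s => map_zero _, fun s => map_zero _, map_zero _, map_zero _⟩
  · intro x y _ _ hx hy
    exact ⟨fun s => by rw [map_add, hx.1 s, hy.1 s, add_zero], fun s => by rw [map_add, hx.2.1 s, hy.2.1 s, add_zero],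
      by rw [map_add, hx.2.2.1, hy.2.2.1, add_zero], by rw [map_add, hx.2.2.2, hy.2.2.2, add_zero]⟩
  · intro c x _ hx
    exact ⟨fun s => by rw [map_smul, hx.1 s, smul_zero], fun s => by rw [map_smul, hx.2.1 s, smul_zero],
      by rw [map_smul, hx.2.2.1, smul_zero], by rw [map_smul, hx.2.2.2, smul_zero]⟩

/-- **Normal reduction.**  Modulo `S ⊔ P₂` every Hodge vector is congruent to a Hodge vector supported on the normal residual labels, with the
same functionals (`S ≤ H₂` covering the non-residual labels and killed by the functionals). [folklore] -/
theorem exists_normal (hA : Odd (Fintype.card A)) (S : Submodule ℤ (Ty₂ A → ℤ)) (hSH : S ≤ hodge₂ A)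
    (hcover : ∀ Ψ : Ty₂ A, 2 ≤ pot A Ψ → ∃ v ∈ S, v Ψ = 1 ∧ ∀ χ, χ ≠ Ψ → v χ ≠ 0 → pot A χ < pot A Ψ)
    (hkill : ∀ v ∈ S, ((∀ s, U A s v = 0) ∧ (∀ s, U' A s v = 0) ∧ C₀ A v = 0 ∧ C₁ A v = 0)) {y : Ty₂ A → ℤ} (hy : y ∈ hodge₂ A) :
    ∃ r : Ty₂ A → ℤ, (∀ Ψ, r Ψ ≠ 0 → pot A Ψ ≤ 1) ∧ (∀ Ψ, r Ψ ≠ 0 → wt A Ψ.1 ≤ Fintype.card A / 2) ∧ r ∈ hodge₂ A ∧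
      y - r ∈ S ⊔ pairs₂ A ∧ ((∀ s, U A s (y - r) = 0) ∧ (∀ s, U' A s (y - r) = 0) ∧ C₀ A (y - r) = 0 ∧ C₁ A (y - r) = 0) := by
  obtain ⟨r₀, hr₀, hyr₀⟩ := descent₂ A S hcover (Fintype.card A) y (fun χ _ => pot_le A χ)
  refine ⟨nrm₂ A r₀, fun Ψ h => ?_, fun Ψ h => isLow_of_nrm₂_ne_zero A r₀ h, ?_, ?_, ?_⟩
  · rcases nrm₂_ne_zero A r₀ h with h' | h'
    · exact hr₀ Ψ h'
    · rw [← pot_conj]; exact hr₀ _ h'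
  · have e : nrm₂ A r₀ = y - (y - r₀) - (r₀ - nrm₂ A r₀) := by abel
    rw [e]
    exact Submodule.sub_mem _ (Submodule.sub_mem _ hy (hSH hyr₀)) (pairs₂_le_hodge₂ A (sub_nrm₂_mem A hA r₀))
  · have e : y - nrm₂ A r₀ = (y - r₀) + (r₀ - nrm₂ A r₀) := by abel
    rw [e]
    exact Submodule.add_mem _ (Submodule.mem_sup_left hyr₀) (Submodule.mem_sup_right (sub_nrm₂_mem A hA r₀))
  · have e : y - nrm₂ A r₀ = (y - r₀) - (-(r₀ - nrm₂ A r₀)) := by abel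
    rw [e]
    refine killed_sub A (hkill _ hyr₀) ?_
    have := killed_of_mem_pairs₂ A hA (Submodule.neg_mem _ (sub_nrm₂_mem A hA r₀))
    exact this

/-! ## §2 The generation theorem -/

/-- The combination of generators realising prescribed functionals. [folklore] -/
noncomputable def gen (a : A → ℤ) (k₁ : ℤ) (a' : A → ℤ) (k₀ : ℤ) : Ty₂ A → ℤ :=
  ∑ s : A, a s • genU A s + k₁ • genC₁ A + ∑ s : A, a' s • genU' A s + k₀ • genC₀ A

/-- `gen` lies in the closing span. [folklore] -/
theorem gen_mem_closingSpan (a : A → ℤ) (k₁ : ℤ) (a' : A → ℤ) (k₀ : ℤ) : gen A a k₁ a' k₀ ∈ closingSpan A := by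
  unfold gen
  refine Submodule.add_mem _ (Submodule.add_mem _ (Submodule.add_mem _ ?_ ?_) ?_) ?_
  · exact Submodule.sum_mem _ fun s _ => Submodule.smul_mem _ _ (gen_mem A s).1
  · exact Submodule.smul_mem _ _ (gen_mem A (0 : A)).2.2.1
  · exact Submodule.sum_mem _ fun s _ => Submodule.smul_mem _ _ (gen_mem A s).2.1
  · exact Submodule.smul_mem _ _ (gen_mem A (0 : A)).2.2.2

/-- **The functionals of `gen a k₁ a' k₀` are `(a, |A| k₁, a', |A| k₀)`.** [folklore] -/
theorem gen_spec (hA : Odd (Fintype.card A)) (h3 : 3 ≤ Fintype.card A) (a : A → ℤ) (k₁ : ℤ) (a' : A → ℤ) (k₀ : ℤ) (t : A) :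
    U A t (gen A a k₁ a' k₀) = a t ∧ U' A t (gen A a k₁ a' k₀) = a' t ∧ C₁ A (gen A a k₁ a' k₀) = Fintype.card A * k₁ ∧
      C₀ A (gen A a k₁ a' k₀) = Fintype.card A * k₀ := by
  have gU := fun s => genU_spec A hA h3 s t
  have gU' := fun s => genU'_spec A hA h3 s t
  have gC₁ := genC₁_spec A hA h3 t
  have gC₀ := genC₀_spec A hA h3 t
  have gUC : ∀ s, C₁ A (genU A s) = 0 ∧ C₀ A (genU A s) = 0 := fun s => ⟨(genU_spec A hA h3 s s).2.2.1, (genU_spec A hA h3 s s).2.2.2⟩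
  have gU'C : ∀ s, C₀ A (genU' A s) = 0 ∧ C₁ A (genU' A s) = 0 := fun s => ⟨(genU'_spec A hA h3 s s).2.2.1, (genU'_spec A hA h3 s s).2.2.2⟩
  unfold gen
  refine ⟨?_, ?_, ?_, ?_⟩
  · simp only [map_add, map_sum, map_zsmul, smul_eq_mul, fun s => (gU s).1, fun s => (gU' s).2.1, gC₁.1, gC₀.1, mul_zero,
      Finset.sum_const_zero, add_zero, mul_ite, mul_one]
    rw [Finset.sum_ite_eq univ t, if_pos (Finset.mem_univ _)]
  · simp only [map_add, map_sum, map_zsmul, smul_eq_mul, fun s => (gU s).2.1, fun s => (gU' s).1, gC₁.2.1, gC₀.2.1, mul_zero,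
      Finset.sum_const_zero, add_zero, zero_add, mul_ite, mul_one]
    rw [Finset.sum_ite_eq univ t, if_pos (Finset.mem_univ _)]
  · simp only [map_add, map_sum, map_zsmul, smul_eq_mul, fun s => (gUC s).1, fun s => (gU'C s).2, gC₁.2.2.1, gC₀.2.2.1, mul_zero,
      Finset.sum_const_zero, add_zero, zero_add]
    ring
  · simp only [map_add, map_sum, map_zsmul, smul_eq_mul, fun s => (gUC s).2, fun s => (gU'C s).1, gC₁.2.2.2, gC₀.2.2.2, mul_zero,
      Finset.sum_const_zero, add_zero, zero_add]
    ring

/-- **THE GENERATION THEOREM of the dicyclic twist.**  For `|A|` odd `≥ 3` and every submodule `S ≤ H₂` covering the non-residual labels by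
potential-reducing vectors and killed by the residual functionals: `H₂ ≤ P₂ ⊔ S ⊔ closingSpan`. [folklore] -/
theorem hodge₂_le (hA : Odd (Fintype.card A)) (h3 : 3 ≤ Fintype.card A) (S : Submodule ℤ (Ty₂ A → ℤ)) (hSH : S ≤ hodge₂ A)
    (hcover : ∀ Ψ : Ty₂ A, 2 ≤ pot A Ψ → ∃ v ∈ S, v Ψ = 1 ∧ ∀ χ, χ ≠ Ψ → v χ ≠ 0 → pot A χ < pot A Ψ)
    (hkill : ∀ v ∈ S, ((∀ s, U A s v = 0) ∧ (∀ s, U' A s v = 0) ∧ C₀ A v = 0 ∧ C₁ A v = 0)) : hodge₂ A ≤ pairs₂ A ⊔ S ⊔ closingSpan A := by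
  intro y hy
  have hm : (Fintype.card A : ℤ) ≠ 0 := by exact_mod_cast (show Fintype.card A ≠ 0 by omega)
  -- normal reduction of `y` and its functionals
  obtain ⟨r, hrp, hrl, hrH, hyr, hk⟩ := exists_normal A hA S hSH hcover hkill hy
  obtain ⟨k₁, hk₁⟩ := card_dvd_C₁ h3 hrp hrl hrH
  obtain ⟨k₀, hk₀⟩ := card_dvd_C₀ h3 hrp hrl hrH
  -- the element of the closing span with the same functionals
  set n := gen A (fun s => U A s r) k₁ (fun s => U' A s r) k₀ with hn
  have hnspec := gen_spec A hA h3 (fun s => U A s r) k₁ (fun s => U' A s r) k₀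
  have hnH : n ∈ hodge₂ A := closingSpan_le_hodge₂ A h3 (gen_mem_closingSpan A _ _ _ _)
  -- the difference has vanishing functionals
  have hd : ((∀ s, U A s (y - n) = 0) ∧ (∀ s, U' A s (y - n) = 0) ∧ C₀ A (y - n) = 0 ∧ C₁ A (y - n) = 0) := by
    have hyr' : ∀ s, U A s y = U A s r ∧ U' A s y = U' A s r := fun s =>
      ⟨by have := hk.1 s; rw [map_sub] at this; linarith, by have := hk.2.1 s; rw [map_sub] at this; linarith⟩
    have hyC : C₀ A y = C₀ A r ∧ C₁ A y = C₁ A r :=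
      ⟨by have := hk.2.2.1; rw [map_sub] at this; linarith, by have := hk.2.2.2; rw [map_sub] at this; linarith⟩
    refine ⟨fun s => ?_, fun s => ?_, ?_, ?_⟩
    · rw [map_sub, (hnspec s).1, (hyr' s).1, sub_self]
    · rw [map_sub, (hnspec s).2.1, (hyr' s).2, sub_self]
    · rw [map_sub, (hnspec (0 : A)).2.2.2, hyC.1, hk₀, sub_self]
    · rw [map_sub, (hnspec (0 : A)).2.2.1, hyC.2, hk₁, sub_self]
  -- normal reduction of the difference vanishes
  obtain ⟨r', hr'p, hr'l, hr'H, hdr', hk'⟩ := exists_normal A hA S hSH hcover hkill (Submodule.sub_mem _ hy hnH)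
  have hr'k : ((∀ s, U A s r' = 0) ∧ (∀ s, U' A s r' = 0) ∧ C₀ A r' = 0 ∧ C₁ A r' = 0) := by
    have e : r' = (y - n) - ((y - n) - r') := by abel
    rw [e]; exact killed_sub A hd hk'
  have hr'0 : r' = 0 := eq_zero_of_normal h3 hr'p hr'l hr'H hr'k.1 hr'k.2.1 hr'k.2.2.1 hr'k.2.2.2
  rw [hr'0, sub_zero] at hdr'
  -- assemble
  have e : y = (y - n) + n := by abel
  rw [e]
  refine Submodule.add_mem _ ?_ (Submodule.mem_sup_right (gen_mem_closingSpan A _ _ _ _))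
  refine Submodule.mem_sup_left ?_
  rcases Submodule.mem_sup.mp hdr' with ⟨s₁, hs₁, p₁, hp₁, hsp⟩
  rw [← hsp]
  exact Submodule.add_mem _ (Submodule.mem_sup_right hs₁) (Submodule.mem_sup_left hp₁)

/-! ## §3 The span of all reducing faces is an admissible `S` -/

/-- The span of all reducing faces. [folklore] -/
def redSpan : Submodule ℤ (Ty₂ A → ℤ) := Submodule.span ℤ {v | ∃ Ψ : Ty₂ A, 2 ≤ pot A Ψ ∧ v = redFace A Ψ}

/-- The reducing faces are Hodge vectors: `redSpan ≤ H₂`. [folklore] -/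
theorem redSpan_le_hodge₂ : redSpan A ≤ hodge₂ A := by
  refine Submodule.span_le.mpr ?_
  rintro v ⟨Ψ, hΨ, rfl⟩
  exact redFace_mem A hΨ

/-- Every reducing face lies in `redSpan`. [folklore] -/
theorem redFace_mem_redSpan {Ψ : Ty₂ A} (h : 2 ≤ pot A Ψ) : redFace A Ψ ∈ redSpan A :=
  Submodule.subset_span ⟨Ψ, h, rfl⟩

/-- **The functionals kill `redSpan`.** [folklore] -/
theorem killed_of_mem_redSpan (hA : Odd (Fintype.card A)) {v : Ty₂ A → ℤ} (hv : v ∈ redSpan A) : ((∀ s, U A s v = 0) ∧ (∀ s, U' A s v = 0) ∧ C₀ A v = 0 ∧ C₁ A v = 0) := by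
  refine Submodule.span_induction (p := fun w _ => ((∀ s, U A s w = 0) ∧ (∀ s, U' A s w = 0) ∧ C₀ A w = 0 ∧ C₁ A w = 0)) ?_ ?_ ?_ ?_ hv
  · rintro _ ⟨Ψ, hΨ, rfl⟩
    exact ⟨fun s => U_redFace A hA s hΨ, fun s => U'_redFace A hA s hΨ, C₀_redFace A hA hΨ, C₁_redFace A hA hΨ⟩
  · exact ⟨fun s => map_zero _, fun s => map_zero _, map_zero _, map_zero _⟩
  · intro x y _ _ hx hy
    exact ⟨fun s => by rw [map_add, hx.1 s, hy.1 s, add_zero], fun s => by rw [map_add, hx.2.1 s, hy.2.1 s, add_zero],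
      by rw [map_add, hx.2.2.1, hy.2.2.1, add_zero], by rw [map_add, hx.2.2.2, hy.2.2.2, add_zero]⟩
  · intro c x _ hx
    exact ⟨fun s => by rw [map_smul, hx.1 s, smul_zero], fun s => by rw [map_smul, hx.2.1 s, smul_zero],
      by rw [map_smul, hx.2.2.1, smul_zero], by rw [map_smul, hx.2.2.2, smul_zero]⟩

/-- **MAIN COROLLARY: the reducing faces and the two closing squares generate the Hodge lattice of `(Dic(A), c)` modulo pairs**
(`|A|` odd `≥ 3`): `H₂ ≤ P₂ ⊔ redSpan ⊔ closingSpan`. [folklore] -/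
theorem hodge₂_le_redSpan (hA : Odd (Fintype.card A)) (h3 : 3 ≤ Fintype.card A) :
    hodge₂ A ≤ pairs₂ A ⊔ redSpan A ⊔ closingSpan A :=
  hodge₂_le A hA h3 (redSpan A) (redSpan_le_hodge₂ A)
    (fun Ψ hΨ => ⟨redFace A Ψ, redFace_mem_redSpan A hΨ, redFace_spec A hΨ⟩) (fun _ hv => killed_of_mem_redSpan A hA hv)

/-- Conversely the three summands are Hodge: **`P₂ ⊔ redSpan ⊔ closingSpan = H₂`.** [folklore] -/
theorem sup_eq_hodge₂ (hA : Odd (Fintype.card A)) (h3 : 3 ≤ Fintype.card A) :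
    pairs₂ A ⊔ redSpan A ⊔ closingSpan A = hodge₂ A :=
  le_antisymm (sup_le (sup_le (pairs₂_le_hodge₂ A) (redSpan_le_hodge₂ A)) (closingSpan_le_hodge₂ A h3)) (hodge₂_le_redSpan A hA h3)

end Summit.HodgeConjecture.CorCM.Census.DicyclicTwist
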